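/-
Origin: expansion seat `planner-pub-hodgecm-prl1-g3-0`, handover #8 v2 2026-08-18T06:28:44Z (`HOME/pub-hodgecm-prl1-g3/lean/Prl1g3/MatrixCoefficients.lean`, md5 eec737b2, 184 lines);
landed by the gen-7 packager in gate run 25 REPLACES the earlier landed copy of `HodgeCM/Automorphic/MatrixCoefficients.lean` (import ^import Prl1g3\.→import HodgeCM.Automorphic. ×1).
-/
/-
Copyright: HodgeCMPerL adjudication package. WIP seat prl1-g3 (planner-pub-hodgecm-prl1-g3-0), file 8.
-/
import Summits.HodgeConjecture.HodgeCM.Automorphic.DiscreteDecomposition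

/-!
# Matrix coefficients of an irreducible representation do not vanish identically — the Hilbert-space half of (I5)

The REDUCE seat's print-interface clause (I5) `IsoDatum.Translate` (`HodgeCM.StubTree.PairingReduction`, prl2-g4) —
"Hecke translates inside ONE constituent pair non-trivially" — is derived in its docstring from three ingredients:
MULTIPLICITY ONE for the discrete spectrum of `G_U` (Rogawski, Ann. of Math. Stud. 123, Thm 13.3.3(c), 14.6.2, 14.6.4,
14.6.5 — PRINT), the Matsushima / Petersson dictionary (PRINT + model seams), and the representation-theoretic fact

  "the matrix coefficient `g ↦ ⟨π(g)u, u′⟩` of an IRREDUCIBLE unitary representation is not identically zero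
   (else `u′ ⊥` the closed span of `G·u = π`), and a dense subgroup (or one with `G = Λ · Stab(u)`) already pairs".

This file proves that last ingredient in the kernel, for any representation `R : G →* (H →L[ℂ] H)` on a complex
Hilbert space, together with the NEGATIVE statement that makes multiplicity one load-bearing:

* `inner_orbit_eq_zero_of_mem_orthogonal` — if `V` is invariant, `u ∈ V` and `u′ ∈ Vᗮ`, then `⟪R g u, u′⟫ = 0` for
  every `g`: two orthogonal copies NEVER pair ((I5) fails at multiplicity `≥ 2`, as `PairingReduction` says);
* `exists_inner_orbit_ne_zero` — if `V` is an irreducible closed invariant subspace and `u, u′ ∈ V` are nonzero, then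
  `⟪R g u, u′⟫ ≠ 0` for some `g` (via the landed `RepDecomp.cyclic_le`);
* `exists_inner_orbit_orbit_ne_zero` — the two-sided form `⟪R g u, R g′ u′⟫ ≠ 0` for unitary `R`;
* `exists_mem_dense_inner_orbit_ne_zero` — if `g ↦ R g u` is continuous and `Λ ⊆ G` is dense, some `γ ∈ Λ` pairs;
* `exists_mem_inner_orbit_ne_zero_of_coset` — if `G = Λ · Stab_R(u)`, some `γ ∈ Λ` pairs (no topology);
* `exists_mem_inner_orbit_ne_zero_of_doubleCoset`, `inner_orbit_doubleCoset_eq` — for unitary `R` the coefficient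
  is constant on double cosets `Stab(u′) g Stab(u)`, so if `G = Stab(u′) · Λ · Stab(u)` some `γ ∈ Λ` pairs (the SUPPORT
  argument of prl2-g4's corrected (I5) sketch);
* `exists_inner_orbit_ne_zero_of_isotypic_irreducible` — the multiplicity-one packaging: if the isotypic component
  `isotypic R c` is itself irreducible, every two nonzero vectors in it pair under some translate.

What remains PRINT in (I5) after this file: multiplicity one (Rogawski) and the dictionary.  Kernel-checked, no new
axioms; imports this seat's `DiscreteDecomposition` (run 24) only.
-/

noncomputable section

open scoped Topology InnerProductSpace

namespace HodgeCM
namespace RepDecomp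

open HodgeCM.PerL34 HodgeCM.PerL34.Spectral

variable {H : Type*} [NormedAddCommGroup H] [InnerProductSpace ℂ H]
variable {G : Type*} [Group G] {R : G →* (H →L[ℂ] H)}

/-! ## 1. The negative: orthogonal invariant pieces never pair -/

/-- **Two orthogonal copies never pair.**  If `V` is invariant, `u ∈ V` and `u′ ∈ Vᗮ`, every matrix coefficient
`⟪R g u, u′⟫` vanishes.  (This is why (I5) is LOAD-BEARING on multiplicity one.) -/
theorem inner_orbit_eq_zero_of_mem_orthogonal {V : Submodule ℂ H} (hV : Invariant R V) {u u' : H} (hu : u ∈ V)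
    (hu' : u' ∈ Vᗮ) (g : G) : ⟪R g u, u'⟫_ℂ = 0 :=
  Submodule.inner_right_of_mem_orthogonal (hV g u hu) hu'

/-- Symmetric form: `u ∈ Vᗮ`, `u′ ∈ V`, with `Vᗮ` invariant (e.g. `R` unitary and `V` closed invariant). -/
theorem inner_orbit_eq_zero_of_mem_orthogonal' {V : Submodule ℂ H} (hV : Invariant R Vᗮ) {u u' : H} (hu : u ∈ Vᗮ)
    (hu' : u' ∈ V) (g : G) : ⟪R g u, u'⟫_ℂ = 0 :=
  Submodule.inner_left_of_mem_orthogonal hu' (hV g u hu)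

/-! ## 2. The positive: coefficients of an irreducible do not vanish identically -/

/-- If all coefficients `⟪R g u, u′⟫` vanish, `u′` is orthogonal to the closed cyclic subspace of `u`. -/
theorem cyclic_le_orthogonal_of_inner_orbit_eq_zero {u u' : H} (h : ∀ g : G, ⟪R g u, u'⟫_ℂ = 0) :
    cyclic R u ≤ (ℂ ∙ u')ᗮ := by
  refine Submodule.topologicalClosure_minimal _ ?_ (Submodule.isClosed_orthogonal _)
  rw [Submodule.span_le]
  rintro _ ⟨g, rfl⟩
  exact Submodule.mem_orthogonal_singleton_iff_inner_left.mpr (h g)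

/-- **Matrix coefficients of an irreducible representation do not vanish identically.**  If `V` is an irreducible
closed invariant subspace and `u, u′ ∈ V` are nonzero, then `⟪R g u, u′⟫ ≠ 0` for some `g ∈ G`. -/
theorem exists_inner_orbit_ne_zero {V : Submodule ℂ H} (hV : IsIrreducible R V) {u u' : H} (hu : u ∈ V)
    (hu0 : u ≠ 0) (hu' : u' ∈ V) (hu'0 : u' ≠ 0) : ∃ g : G, ⟪R g u, u'⟫_ℂ ≠ 0 := by
  by_contra h
  push Not at h
  -- the closed cyclic subspace of `u` is a nonzero closed invariant subspace of `V`, hence all of `V`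
  have hle : cyclic R u ≤ V := cyclic_le hV.isClosed hV.invariant hu
  have hW : cyclic R u = V := by
    rcases hV.irred (cyclic R u) hle (isClosed_cyclic u) (cyclic_invariant u) with h0 | h1
    · exact absurd ((Submodule.eq_bot_iff _).mp h0 u (mem_cyclic_self u)) hu0
    · exact h1
  -- so `u' ∈ V = cyclic R u ⊥ u'`
  have hperp : u' ∈ (ℂ ∙ u')ᗮ := cyclic_le_orthogonal_of_inner_orbit_eq_zero h (hW ▸ hu')
  exact hu'0 (inner_self_eq_zero.mp (Submodule.mem_orthogonal_singleton_iff_inner_left.mp hperp))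

/-- Two-sided form for a UNITARY representation: `⟪R g u, R g′ u′⟫ ≠ 0` for some `g`, whatever `g′`. -/
theorem exists_inner_orbit_orbit_ne_zero (hR : IsUnitaryRep R) {V : Submodule ℂ H} (hV : IsIrreducible R V)
    {u u' : H} (hu : u ∈ V) (hu0 : u ≠ 0) (hu' : u' ∈ V) (hu'0 : u' ≠ 0) (g' : G) :
    ∃ g : G, ⟪R g u, R g' u'⟫_ℂ ≠ 0 := by
  refine exists_inner_orbit_ne_zero hV hu hu0 (hV.invariant g' u' hu') ?_
  intro h0
  apply hu'0
  have : ⟪R g' u', R g' u'⟫_ℂ = 0 := by rw [h0, inner_zero_left]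
  rw [hR g' u' u'] at this
  exact inner_self_eq_zero.mp this

/-- The coefficient `⟪R g u, R g′ u′⟫` depends only on `g′⁻¹ g` (unitarity). -/
theorem inner_orbit_orbit_eq (hR : IsUnitaryRep R) (u u' : H) (g g' : G) :
    ⟪R g u, R g' u'⟫_ℂ = ⟪R (g'⁻¹ * g) u, u'⟫_ℂ := by
  conv_lhs => rw [show g = g' * (g'⁻¹ * g) by group, mul_apply' R]
  exact hR g' _ _

/-! ## 3. Pairing by a dense subgroup, or by coset representatives -/

/-- The set of group elements whose coefficient does not vanish is open when the orbit map of `u` is continuous. -/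
theorem isOpen_setOf_inner_orbit_ne_zero [TopologicalSpace G] {u : H} (hc : Continuous fun g : G => R g u)
    (u' : H) : IsOpen {g : G | ⟪R g u, u'⟫_ℂ ≠ 0} :=
  isOpen_ne_fun (Continuous.inner hc continuous_const) continuous_const

/-- **A dense subset already pairs.**  If `g ↦ R g u` is continuous (e.g. `R` strongly continuous) and `Λ ⊆ G` is
dense, then for `V` irreducible and nonzero `u, u′ ∈ V` some `γ ∈ Λ` has `⟪R γ u, u′⟫ ≠ 0`. -/
theorem exists_mem_dense_inner_orbit_ne_zero [TopologicalSpace G] {Λ : Set G} (hΛ : Dense Λ)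
    {V : Submodule ℂ H} (hV : IsIrreducible R V) {u u' : H} (hc : Continuous fun g : G => R g u) (hu : u ∈ V)
    (hu0 : u ≠ 0) (hu' : u' ∈ V) (hu'0 : u' ≠ 0) : ∃ γ ∈ Λ, ⟪R γ u, u'⟫_ℂ ≠ 0 :=
  hΛ.exists_mem_open (isOpen_setOf_inner_orbit_ne_zero hc u') (exists_inner_orbit_ne_zero hV hu hu0 hu' hu'0)

/-- **Coset representatives already pair** (no topology): if every `g` factors as `γ * k` with `γ ∈ Λ` and `k`
fixing `u` (`G = Λ · Stab_R(u)`), then some `γ ∈ Λ` has `⟪R γ u, u′⟫ ≠ 0`. -/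
theorem exists_mem_inner_orbit_ne_zero_of_coset {Λ : Set G} {u : H}
    (hcov : ∀ g : G, ∃ γ ∈ Λ, ∃ k : G, R k u = u ∧ g = γ * k)
    {V : Submodule ℂ H} (hV : IsIrreducible R V) {u' : H} (hu : u ∈ V) (hu0 : u ≠ 0) (hu' : u' ∈ V)
    (hu'0 : u' ≠ 0) : ∃ γ ∈ Λ, ⟪R γ u, u'⟫_ℂ ≠ 0 := by
  obtain ⟨g, hg⟩ := exists_inner_orbit_ne_zero hV hu hu0 hu' hu'0
  obtain ⟨γ, hγ, k, hk, rfl⟩ := hcov g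
  exact ⟨γ, hγ, by rwa [mul_apply' R, hk] at hg⟩

/-- Right invariance of the coefficient under the stabiliser of `u`: `⟪R (g k) u, u′⟫ = ⟪R g u, u′⟫` if `R k u = u`. -/
theorem inner_orbit_mul_right_of_fixed {u : H} {k : G} (hk : R k u = u) (g : G) (u' : H) :
    ⟪R (g * k) u, u'⟫_ℂ = ⟪R g u, u'⟫_ℂ := by
  rw [mul_apply' R, hk]

/-- Left invariance of the coefficient under the stabiliser of `u′`, for UNITARY `R`: `⟪R (k′ g) u, u′⟫ = ⟪R g u, u′⟫`
if `R k′ u′ = u′`. -/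
theorem inner_orbit_mul_left_of_fixed (hR : IsUnitaryRep R) {u' : H} {k' : G} (hk' : R k' u' = u') (g : G)
    (u : H) : ⟪R (k' * g) u, u'⟫_ℂ = ⟪R g u, u'⟫_ℂ := by
  conv_lhs => rw [← hk', mul_apply' R]
  exact hR k' _ _

/-- **Double-coset representatives already pair** (the SUPPORT argument of prl2-g4's corrected (I5) sketch,
2026-08-18 06:25Z: "`Q(g) ≠ 0 ⇒ g ∈ K′γK ⇒ Q(g) = Q(γ)`, `γ` rational"): for UNITARY `R`, if every `g` factors as
`k′ * γ * k` with `γ ∈ Λ`, `k` fixing `u` and `k′` fixing `u′` (`G = Stab(u′) · Λ · Stab(u)`), then for `V` irreducible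
and nonzero `u, u′ ∈ V` some `γ ∈ Λ` has `⟪R γ u, u′⟫ ≠ 0` — no topology, no density. -/
theorem exists_mem_inner_orbit_ne_zero_of_doubleCoset (hR : IsUnitaryRep R) {Λ : Set G} {u u' : H}
    (hcov : ∀ g : G, ∃ k' : G, ∃ γ ∈ Λ, ∃ k : G, R k u = u ∧ R k' u' = u' ∧ g = k' * γ * k)
    {V : Submodule ℂ H} (hV : IsIrreducible R V) (hu : u ∈ V) (hu0 : u ≠ 0) (hu' : u' ∈ V) (hu'0 : u' ≠ 0) :
    ∃ γ ∈ Λ, ⟪R γ u, u'⟫_ℂ ≠ 0 := by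
  obtain ⟨g, hg⟩ := exists_inner_orbit_ne_zero hV hu hu0 hu' hu'0
  obtain ⟨k', γ, hγ, k, hk, hk', rfl⟩ := hcov g
  refine ⟨γ, hγ, ?_⟩
  rwa [inner_orbit_mul_right_of_fixed hk, inner_orbit_mul_left_of_fixed hR hk'] at hg

/-- The coefficient is constant on double cosets `Stab(u′) g Stab(u)` (unitary `R`). -/
theorem inner_orbit_doubleCoset_eq (hR : IsUnitaryRep R) {u u' : H} {k k' : G} (hk : R k u = u)
    (hk' : R k' u' = u') (g : G) : ⟪R (k' * g * k) u, u'⟫_ℂ = ⟪R g u, u'⟫_ℂ := by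
  rw [inner_orbit_mul_right_of_fixed hk, inner_orbit_mul_left_of_fixed hR hk']

/-! ## 4. The multiplicity-one packaging -/

/-- **Multiplicity one ⇒ (I5)-shape pairing inside an isotypic component.**  If the isotypic component `isotypic R c`
is itself an irreducible closed invariant subspace (multiplicity one for the class `c`), any two nonzero vectors of
it pair under some translate. -/
theorem exists_inner_orbit_ne_zero_of_isotypic_irreducible {c : IsoClass R}
    (hc : IsIrreducible R (isotypic R c)) {u u' : H} (hu : u ∈ isotypic R c) (hu0 : u ≠ 0)
    (hu' : u' ∈ isotypic R c) (hu'0 : u' ≠ 0) : ∃ g : G, ⟪R g u, u'⟫_ℂ ≠ 0 :=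
  exists_inner_orbit_ne_zero hc hu hu0 hu' hu'0

/-- … and with a dense `Λ`. -/
theorem exists_mem_dense_inner_orbit_ne_zero_of_isotypic_irreducible [TopologicalSpace G]
    {Λ : Set G} (hΛ : Dense Λ) {c : IsoClass R} (hc : IsIrreducible R (isotypic R c)) {u u' : H}
    (hcu : Continuous fun g : G => R g u) (hu : u ∈ isotypic R c) (hu0 : u ≠ 0) (hu' : u' ∈ isotypic R c)
    (hu'0 : u' ≠ 0) : ∃ γ ∈ Λ, ⟪R γ u, u'⟫_ℂ ≠ 0 :=
  exists_mem_dense_inner_orbit_ne_zero hΛ hc hcu hu hu0 hu' hu'0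

/-- Conversely, at multiplicity `≥ 2` the (I5)-shape FAILS: two distinct members `V ≠ W` of the same class that are
orthogonal (`W ≤ Vᗮ`, which `orthogonal_or_equiv` does NOT exclude for equivalent pieces — equivalent irreducibles can
be orthogonal, e.g. the two copies in `V ⊕ V`) carry nonzero vectors that never pair. -/
theorem not_pairing_of_orthogonal_members {V W : Submodule ℂ H} (hV : Invariant R V) (hWV : W ≤ Vᗮ) {u u' : H}
    (hu : u ∈ V) (hu' : u' ∈ W) : ∀ g : G, ⟪R g u, u'⟫_ℂ = 0 :=
  fun g => inner_orbit_eq_zero_of_mem_orthogonal hV hu (hWV hu') g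

end RepDecomp
end HodgeCM
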